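import Summits.QuantumFields.YangMills.Theorems.BalabanUVNodesN16CentreConventionAllDepths
import Summits.QuantumFields.BalabanUV.T4Continuum.Support.MinimalActionWitness
import HarnessLib

/-!
# YM-DAG node N16 (NE3), the located averaging pin (42) ↔ (0.4) — part 21: PART 12's CRITERION IS STRICTLY STRONGER THAN PART 14's — the centre-convention torus (42)
# `cstep` is `SchemeGaugeEquiv`-equivalent to (43) at every depth (part 16) but FAILS `ExactGaugeDefect` (its corner-valued covariance clause) already at depth 1

Cell `pub-ymgap`, width seat `pub-ymgap-dag-n16-w3` (director-ym №197 ∕ HUMAN RULING D-0149), generation 7; part 21 of the W1b lineage (part 12 p612224 `ExactGaugeDefect`; part 14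
p616704 `SchemeGaugeEquiv`; part 16 p622848 `schemeGaugeEquiv_step42_cstep`).  `--kind proof --supports stmt-QuantumFields-27366 --as helper` (K3⁸; count-neutral; 0 `def`).
`bears_on: R4∕N16`.

THE POINT (an honesty marker about this lineage's two criteria).  Part 12's `ExactGaugeDefect d s L N k C` asks (cov): `avgIterS s k (U^u) = (avgIterS s k U)^{ū}` with the CORNER
values `ū = uLev L u k` for EVERY unitary `(N·L^k)`-periodic gauge `u`; part 14's `SchemeGaugeEquiv` asks covariance only under BLOCK LIFTS (constant on blocks, corner value =
centre value).  The tree's NE7 torus instance of (42), `QLaTorusB7Averaging.cstep`, is CENTRE-covariant (`cstep_gaugeAct`: the datum moves by `u ∘ cen`).  §1 exhibits, for every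
`P : Params` (`L` odd `≥ 3`, `d ≥ 1`), every `N ≥ 1` and every unit-torus side `T ≥ 2`, a unitary `(T·L)`-periodic gauge `u` that is NOT block-constant — `u(x) = −1` if
`x_μ ≡ (L−1)∕2 (mod T·L)`, `u(x) = 1` otherwise — under which (cov) FAILS at the flat configuration: `cstep (1^u)(0, μ) = u(cen 0)·u(cen e_μ)⁻¹ = −1` while the corner recipe
gives `u(0)·u(L e_μ)⁻¹ = 1`.  Hence ★★ `not_exactGaugeDefect_cstep_one`: `¬ ExactGaugeDefect d (cstep) L T 1 (sfClass d L T ε 1)` for every `ε ≥ 0` (the class contains the flat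
configuration, leaf-05∕`MinimalActionWitness.flatCfg_mem_sfClass`), and ★ `schemeGaugeEquiv_and_not_exactGaugeDefect_cstep`: in the (8)-radius regime BOTH «`SchemeGaugeEquiv
(step42) (cstep)` holds» (part 16) AND «`ExactGaugeDefect (cstep)` fails» — part 14's weakening of the covariance clause was NECESSARY, not cosmetic, and every consumer of the
`cstep` results (parts 16–20) must go through `SchemeGaugeEquiv`.
HONEST FRAMING.  [folklore] bookkeeping BY NAME (`cstep_gaugeAct`, `cstep_one`, `flatCfg_mem_sfClass`, `uLev_apply`); ONE explicit witness gauge (displayed in the proofs, no `def`);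
0 `sorry`; nothing of Bałaban asserted; K3⁸ stubs NOT touched; N16 ∕ NE3 NOT discharged; count-neutral (typed 28∕28 · discharged 5∕27 work-bound, A 5∕28 — unmoved).  One finite
four-torus programme at fixed `ε` — the Yang–Mills mass gap (Clay) is NOT proved by any of this; R4 closes the conditional finite-𝕋⁴ rung `BalabanLadder.UV` only; nothing continuum ∕ ℝ⁴ ∕ OS.
-/

set_option autoImplicit false

open scoped BigOperators Matrix Matrix.Norms.L2Operator
open NormedSpace

namespace Summit.QuantumFields.YangMills.BalabanUVNodes.N16ExactGaugeDefectStrict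

open Literature.MathematicalPhysics.QuantumFieldTheory.Balaban1983to89
open B7Prop1Explicit B7Prop2Explicit
open B7AvgGaugeCovariance (uLev uLev_apply)
open Summit.QuantumFields.BalabanUV.T4Continuum
open MinimalActionRate (sfClass)
open MinimalActionWitness (flatCfg flatCfg_mem_sfClass)
open NE3EnergyShapes (IsUnitarySite IsPeriodicSite)
open Summit.QuantumFields.YangMills.BalabanUVNodes.N16AveragingPin (avgIterS step42 avgIterS_const)
open Summit.QuantumFields.YangMills.BalabanUVNodes.N16AveragingTransferOfGaugeDefect (ExactGaugeDefect)
open Summit.QuantumFields.YangMills.BalabanUVNodes.N16CentreConventionTransfer (SchemeGaugeEquiv)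
open Summit.QuantumFields.YangMills.BalabanUVNodes.N16CentreConventionAllDepths (schemeGaugeEquiv_step42_cstep)
open Summit.QuantumFields.BalabanUV.T4Continuum.Spine.NE7.TorusB7 (Mat cstep cen hb hb_le cstep_gaugeAct cstep_one)

noncomputable section

variable {P : Params} {N : ℕ} [NeZero N]

/-! ## §1 The witness gauge and the failure of the corner-valued covariance clause -/

omit [NeZero N] in
/-- `−1 ∈ U(N)`. [folklore] -/
theorem neg_one_mem_unitaryUnits : (-1 : (Mat N)ˣ) ∈ unitaryUnits (Mat N) := by
  rw [mem_unitaryUnits, Units.val_neg, Units.val_one, Unitary.mem_iff]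
  simp

/-- `−1 ≠ 1` in `U(N)`, `N ≥ 1`. [folklore] -/
theorem neg_one_ne_one : (-1 : (Mat N)ˣ) ≠ 1 := by
  intro h
  have h1 : ((-1 : (Mat N)ˣ) : Mat N) = ((1 : (Mat N)ˣ) : Mat N) := by rw [h]
  rw [Units.val_neg, Units.val_one] at h1
  have h2 := congrFun (congrFun h1 (0 : Fin N)) (0 : Fin N)
  simp only [Matrix.neg_apply, Matrix.one_apply_eq] at h2
  norm_num at h2

/-- `L ≥ 3` for Setup's odd `L > 1`, and the half-width `hb = (L−1)∕2` satisfies `1 ≤ hb ≤ L − 1`. [folklore] -/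
theorem one_le_hb : (1 : ℤ) ≤ (hb P : ℤ) := by
  have h3 : 3 ≤ P.L := by
    obtain ⟨⟨m, hm⟩, h1⟩ := P.hL
    omega
  have : 1 ≤ hb P := by unfold hb; omega
  exact_mod_cast this

/-- **★★ `ExactGaugeDefect` FAILS FOR `cstep` AT DEPTH 1** on every small-field class (`ε ≥ 0`, unit-torus side `T ≥ 2`): the unitary `(T·L)`-periodic gauge «`−1` on the hyperplanes
`x_μ ≡ (L−1)∕2 (mod T·L)`, `1` elsewhere» moves `cstep`'s average of the flat configuration by its CENTRE values (`cstep_gaugeAct`), which the corner recipe `uLev L u 1` does not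
reproduce at the bond `(0, μ)`. [folklore] -/
theorem not_exactGaugeDefect_cstep_one (T : ℕ) (hT : 2 ≤ T) {ε : ℝ} (hε : 0 ≤ ε) :
    ¬ ExactGaugeDefect P.d (fun _ => cstep P N) P.L T 1 (sfClass P.d P.L T ε 1) := by
  classical
  intro h
  -- constants
  set μ : Fin P.d := ⟨0, P.hd⟩ with hμ
  set M : ℤ := ((T * P.L ^ 1 : ℕ) : ℤ) with hM
  have hL1 : (1 : ℤ) < (P.L : ℤ) := by exact_mod_cast P.hL.2
  have hb1 : (1 : ℤ) ≤ (hb P : ℤ) := one_le_hb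
  have hbL : (hb P : ℤ) ≤ (P.L : ℤ) - 1 := hb_le P
  have hMeq : M = (T : ℤ) * (P.L : ℤ) := by simp [hM]
  have hT2 : (2 : ℤ) ≤ (T : ℤ) := by exact_mod_cast hT
  have hLM : (P.L : ℤ) + (P.L : ℤ) ≤ M := by rw [hMeq]; nlinarith
  -- the witness gauge
  set u : Site P.d → (Mat N)ˣ := fun x => if x μ % M = (hb P : ℤ) % M then -1 else 1 with hu_def
  have hu : IsUnitarySite u := by
    intro x
    simp only [hu_def]
    split_ifs
    · exact neg_one_mem_unitaryUnits
    · exact (unitaryUnits (Mat N)).one_mem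
  have huP : IsPeriodicSite u M := by
    intro x i
    have hmod : (x + M • e i) μ % M = x μ % M := by
      rw [Pi.add_apply, Pi.smul_apply, smul_eq_mul, Int.add_mul_emod_self_left]
    simp only [hu_def, hmod]
  -- the four values of `u` that matter
  have hbmod : (hb P : ℤ) % M = (hb P : ℤ) := Int.emod_eq_of_lt (by linarith) (by linarith)
  have hc0 : u (cen P 0) = -1 := by
    simp only [hu_def]
    rw [if_pos]
    simp [cen]
  have hc1 : u (cen P (0 + e μ)) = 1 := by
    simp only [hu_def]
    rw [if_neg]
    intro hq
    have hval : cen P (0 + e μ) μ = (P.L : ℤ) + (hb P : ℤ) := by simp [cen, e]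
    rw [hval, hbmod, Int.emod_eq_of_lt (by linarith) (by linarith)] at hq
    linarith
  have hz : u (((P.L : ℤ) ^ 1) • (0 : Site P.d)) = 1 := by
    simp only [hu_def]
    rw [if_neg]
    intro hq
    rw [smul_zero, Pi.zero_apply, Int.zero_emod, hbmod] at hq
    linarith
  have hLe : u (((P.L : ℤ) ^ 1) • (0 + e μ : Site P.d)) = 1 := by
    simp only [hu_def]
    rw [if_neg]
    intro hq
    have hval : (((P.L : ℤ) ^ 1) • (0 + e μ : Site P.d)) μ = (P.L : ℤ) := by simp [e]
    rw [hval, hbmod, Int.emod_eq_of_lt (by linarith) (by linarith)] at hq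
    linarith
  -- (cov) at the flat configuration, bond `(0, μ)`
  haveI : Nonempty (Fin N) := ⟨0⟩
  have hflat : (flatCfg : Site P.d → Fin P.d → (Mat N)ˣ) ∈ sfClass P.d P.L T ε 1 := flatCfg_mem_sfClass P.L T hε 1
  have hcov := h.cov u flatCfg hu huP hflat
  have key := congrFun (congrFun hcov 0) μ
  have h1 : cstep P N (flatCfg : Site P.d → Fin P.d → (Mat N)ˣ) = 1 := cstep_one
  simp only [avgIterS_const, Function.iterate_one] at key
  rw [cstep_gaugeAct hu, h1] at key
  simp only [gaugeAct, Pi.one_apply, mul_one, uLev_apply, hc0, hc1, hz, hLe, inv_one] at key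
  exact neg_one_ne_one key

/-! ## §2 The contrast with part 16 -/

/-- **★ BOTH AT ONCE**: in the (8)-radius regime the centre-convention torus (42) IS pointwise coarse-gauge equivalent to (43) with block-lift covariance at depth 1 (part 16, every
depth in fact) AND is NOT `ExactGaugeDefect`-equivalent — part 12's criterion is strictly stronger than part 14's; consumers of the `cstep` results must use `SchemeGaugeEquiv`. [folklore] -/
theorem schemeGaugeEquiv_and_not_exactGaugeDefect_cstep (T : ℕ) (hT : 2 ≤ T) {ε : ℝ} (hε0 : 0 ≤ ε) (hε1 : 16 * C0 P.d * ε ≤ 3)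
    (hε2 : 1024 * (P.d + 1) * (P.d + 4) * (P.L : ℝ) ^ 2 * ε ≤ 1) :
    SchemeGaugeEquiv P.d (fun _ => step42 P.L) (fun _ => cstep P N) P.L T 1 (sfClass P.d P.L T ε 1) ∧
      ¬ ExactGaugeDefect P.d (fun _ => cstep P N) P.L T 1 (sfClass P.d P.L T ε 1) :=
  ⟨schemeGaugeEquiv_step42_cstep (P := P) (N := N) T 1 hε0 hε1 hε2, not_exactGaugeDefect_cstep_one (P := P) (N := N) T hT hε0⟩

end

end Summit.QuantumFields.YangMills.BalabanUVNodes.N16ExactGaugeDefectStrict
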